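import Mathlib
import Literature.Computability.AlgebraicComplexity.NewtonPolygonTauProductBounds
import HarnessLib

/-!
# Crux `NewtonUnitEquations.DissociatedUniform` (stmt-ValiantsHypothesis-5905): totals law — kinetic counting of chart tops

Counting tools for the chart sweep of the separated ("third curve dominant") regime of the `n = 3` totals law
(memo `Cruxes/DissociatedUniform/NOTES-d1g3.md` §2 L5 second regime; start packet `Cruxes/DissociatedUniform/NOTES-t1.md` §5(i)),
in the `IsStrictTop` chart calculus of `Literature/…/NewtonPolygonTauProductBounds.lean` (weights `w = (σ, t)`, time `t ∈ ℝ`):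

* `card_chartTops_le_card_ties_add_one` — along a time set `J` that is an interval (`Set.OrdConnected`), a finite planar set `F`
  realises at most `1 + #{tie times of pairs of points of F inside J}` distinct strict tops (between two consecutive tops the
  two points tie, at distinct times): a window containing at most one tie time of `F` sees at most two tops of `F`.
* `sum_card_chartTops_le` — for a finite family of time sets that is pairwise ORDERED in time (for any two, one lies entirely
  before the other), `∑_i #tops(F, J_i) ≤ #tops(F, ℝ) + #family`: by interval fibres (`IsStrictTop.of_between`) each `J_i` shares
  at most one top with all later sets together.
* `card_chartTops_add_card_chartTops_le` — the two half-charts `σ = 1`, `σ = -1` double-count at most the unique top and bottom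
  points: `#tops₊(F) + #tops₋(F) ≤ #vert conv(F) + 2`.
Pure planar bookkeeping (no defs, no named facts); the regime theorem that consumes these is filed separately.
[folklore]
-/

set_option linter.dupNamespace false -- `ValiantsHypothesis.ValiantsHypothesis` (summit = problem) in every name

open Matrix Finset

namespace Summit.ValiantsHypothesis.ValiantsHypothesis.Theorems.NewtonUnitEquationsDissociatedUniform

namespace TotalsLaw

open Literature.Computability.AlgebraicComplexity.KPTT.PlanarMinkowski

/-- The pairing of a chart weight `(σ, t)` with a point. [folklore] -/
theorem chart_dotProduct (σ t : ℝ) (x : Fin 2 → ℝ) : ![σ, t] ⬝ᵥ x = σ * x 0 + t * x 1 := by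
  simp [dotProduct, Fin.sum_univ_two]

/-- Along a chart, the advantage `⟨(σ, v), x - y⟩` of `x` over `y` is affine in the time `v`. [folklore] -/
theorem chart_dotProduct_sub_affine (σ v v₀ : ℝ) (x y : Fin 2 → ℝ) :
    ![σ, v] ⬝ᵥ x - ![σ, v] ⬝ᵥ y = (![σ, v₀] ⬝ᵥ x - ![σ, v₀] ⬝ᵥ y) + (v - v₀) * (x 1 - y 1) := by
  simp only [chart_dotProduct]
  ring

/-- **Monotonicity of the sweep.**  If `x` is the strict top at time `t`, `x'` the strict top at a later time `t' > t`, and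
`x ≠ x'`, then `x'` stays strictly above `x` at every time `u ≥ t'` (the advantage of `x` over `x'` is affine in time, positive
at `t` and negative at `t'`). [folklore] -/
theorem lt_of_isStrictTop_of_isStrictTop {σ t t' u : ℝ} {F : Finset (Fin 2 → ℝ)} {x x' : Fin 2 → ℝ}
    (hx : IsStrictTop ![σ, t] F x) (hx' : IsStrictTop ![σ, t'] F x') (hne : x ≠ x') (htt' : t < t') (hu : t' ≤ u) :
    ![σ, u] ⬝ᵥ x < ![σ, u] ⬝ᵥ x' := by
  have e1 : ![σ, t] ⬝ᵥ x' < ![σ, t] ⬝ᵥ x := hx.lt hx'.mem (Ne.symm hne)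
  have e2 : ![σ, t'] ⬝ᵥ x < ![σ, t'] ⬝ᵥ x' := hx'.lt hx.mem hne
  have a1 := chart_dotProduct_sub_affine σ t' t x x'
  have a2 := chart_dotProduct_sub_affine σ u t x x'
  -- the slope is negative
  have hslope : (t' - t) * (x 1 - x' 1) < 0 := by linarith
  have hd : x 1 - x' 1 < 0 := by
    by_contra h
    push Not at h
    have : 0 ≤ (t' - t) * (x 1 - x' 1) := mul_nonneg (by linarith) h
    linarith
  have : (u - t) * (x 1 - x' 1) ≤ (t' - t) * (x 1 - x' 1) := by nlinarith
  linarith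

/-! ### Tops along an interval of times versus tie times -/

open Classical in
/-- **Tops along an interval are separated by tie times.**  Along a time interval `J` (an order-connected set), the number of
distinct strict `(σ, ·)`-tops of `F` is at most one plus the number of tie times `-(σ (p₀ - q₀)) / (p₁ - q₁)` of pairs of points
`p, q ∈ F` with `p₁ ≠ q₁` that fall inside `J`.  In particular a window containing at most one tie time of `F` sees at most two
tops. [folklore] -/
theorem card_chartTops_le_card_ties_add_one (σ : ℝ) (F : Finset (Fin 2 → ℝ)) (J : Set ℝ) (hJ : J.OrdConnected) :
    (F.filter fun x => ∃ t ∈ J, IsStrictTop ![σ, t] F x).card ≤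
      ((((F ×ˢ F).filter fun p => p.1 1 ≠ p.2 1).image
          fun p => -(σ * (p.1 0 - p.2 0)) / (p.1 1 - p.2 1)).filter fun u => u ∈ J).card + 1 := by
  classical
  set X := F.filter fun x => ∃ t ∈ J, IsStrictTop ![σ, t] F x with hXdef
  set Tset := (((F ×ˢ F).filter fun p => p.1 1 ≠ p.2 1).image
      fun p => -(σ * (p.1 0 - p.2 0)) / (p.1 1 - p.2 1)).filter fun u => u ∈ J with hTdef
  by_cases hXe : X = ∅
  · rw [hXe, Finset.card_empty]; exact Nat.zero_le _
  have hXne : X.Nonempty := Finset.nonempty_iff_ne_empty.2 hXe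
  -- a time in `J` for every top
  have hτ : ∀ x ∈ X, ∃ t, t ∈ J ∧ IsStrictTop ![σ, t] F x := fun x hx => by
    obtain ⟨t, ht, htop⟩ := (Finset.mem_filter.1 hx).2
    exact ⟨t, ht, htop⟩
  choose! τ hτJ hτtop using hτ
  -- the last top
  obtain ⟨xm, hxm, hmax⟩ := X.exists_max_image τ hXne
  -- the tie time with the last top
  let tie : (Fin 2 → ℝ) → ℝ := fun x => -(σ * (x 0 - xm 0)) / (x 1 - xm 1)
  have hlt : ∀ x ∈ X, x ≠ xm → τ x < τ xm := by
    intro x hx hne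
    refine lt_of_le_of_ne (hmax x hx) fun heq => hne ?_
    have h1 := hτtop x hx
    rw [heq] at h1
    exact h1.unique (hτtop xm hxm)
  -- for `x ≠ xm`: the slopes differ, the tie time lies in `(τ x, τ xm)` and the two points tie there
  have key : ∀ x ∈ X, x ≠ xm →
      x 1 ≠ xm 1 ∧ τ x < tie x ∧ tie x < τ xm ∧ ![σ, tie x] ⬝ᵥ x = ![σ, tie x] ⬝ᵥ xm := by
    intro x hx hne
    have htx := hlt x hx hne
    have e1 : ![σ, τ x] ⬝ᵥ xm < ![σ, τ x] ⬝ᵥ x := (hτtop x hx).lt (hτtop xm hxm).mem (Ne.symm hne)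
    have e2 : ![σ, τ xm] ⬝ᵥ x < ![σ, τ xm] ⬝ᵥ xm := (hτtop xm hxm).lt (hτtop x hx).mem hne
    have a1 := chart_dotProduct_sub_affine σ (τ xm) (τ x) x xm
    have hd : x 1 - xm 1 < 0 := by
      by_contra h
      push Not at h
      have : 0 ≤ (τ xm - τ x) * (x 1 - xm 1) := mul_nonneg (by linarith) h
      linarith
    have hd0 : x 1 - xm 1 ≠ 0 := hd.ne
    refine ⟨sub_ne_zero.1 hd0, ?_, ?_, ?_⟩
    · -- `τ x < tie x`
      have h0 : 0 < ![σ, τ x] ⬝ᵥ x - ![σ, τ x] ⬝ᵥ xm := by linarith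
      rw [chart_dotProduct, chart_dotProduct] at h0
      show τ x < -(σ * (x 0 - xm 0)) / (x 1 - xm 1)
      rw [lt_div_iff_of_neg hd]
      nlinarith
    · -- `tie x < τ xm`
      have h0 : ![σ, τ xm] ⬝ᵥ x - ![σ, τ xm] ⬝ᵥ xm < 0 := by linarith
      rw [chart_dotProduct, chart_dotProduct] at h0
      show -(σ * (x 0 - xm 0)) / (x 1 - xm 1) < τ xm
      rw [div_lt_iff_of_neg hd]
      nlinarith
    · rw [chart_dotProduct, chart_dotProduct]
      have : -(σ * (x 0 - xm 0)) / (x 1 - xm 1) * (x 1 - xm 1) = -(σ * (x 0 - xm 0)) := div_mul_cancel₀ _ hd0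
      show σ * x 0 + -(σ * (x 0 - xm 0)) / (x 1 - xm 1) * x 1 = σ * xm 0 + -(σ * (x 0 - xm 0)) / (x 1 - xm 1) * xm 1
      nlinarith [this]
  -- the map `x ↦ tie x` sends `X \ {xm}` into `Tset` …
  have hmaps : ∀ x ∈ X.erase xm, tie x ∈ Tset := by
    intro x hx
    obtain ⟨hne, hxX⟩ := Finset.mem_erase.1 hx
    obtain ⟨hd, h1, h2, -⟩ := key x hxX hne
    rw [hTdef, Finset.mem_filter]
    refine ⟨Finset.mem_image.2 ⟨(x, xm), Finset.mem_filter.2 ⟨Finset.mem_product.2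
      ⟨(Finset.mem_filter.1 hxX).1, (Finset.mem_filter.1 hxm).1⟩, hd⟩, rfl⟩, ?_⟩
    exact hJ.out (hτJ x hxX) (hτJ xm hxm) ⟨h1.le, h2.le⟩
  -- … injectively
  have hinj : Set.InjOn tie (X.erase xm : Set (Fin 2 → ℝ)) := by
    intro x hx x' hx' heq
    obtain ⟨hne, hxX⟩ := Finset.mem_erase.1 (Finset.mem_coe.1 hx)
    obtain ⟨hne', hx'X⟩ := Finset.mem_erase.1 (Finset.mem_coe.1 hx')
    by_contra hxx'
    obtain ⟨-, h1, -, h3⟩ := key x hxX hne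
    obtain ⟨-, h1', -, h3'⟩ := key x' hx'X hne'
    -- both tie with `xm` at the same time `u`, after both of their own times
    have hu : ![σ, tie x] ⬝ᵥ x = ![σ, tie x] ⬝ᵥ x' := by rw [h3, heq, h3']
    rcases lt_trichotomy (τ x) (τ x') with h | h | h
    · have := lt_of_isStrictTop_of_isStrictTop (u := tie x) (hτtop x hxX) (hτtop x' hx'X) hxx' h
        (lt_of_lt_of_eq h1' heq.symm).le
      linarith
    · exact hxx' ((hτtop x hxX).unique (h ▸ hτtop x' hx'X))
    · have := lt_of_isStrictTop_of_isStrictTop (hτtop x' hx'X) (hτtop x hxX) (Ne.symm hxx') h h1.le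
      linarith
  have hcard : (X.erase xm).card ≤ Tset.card := Finset.card_le_card_of_injOn tie hmaps hinj
  have := Finset.card_erase_add_one hxm
  omega

/-! ### An ordered family of time sets shares few tops -/

open Classical in
/-- **Ordered families.**  If the time sets `J i`, `i ∈ I`, are pairwise ordered (for `i ≠ j` every time of one is smaller than
every time of the other), then `∑_{i ∈ I} #tops(F, J i) ≤ #tops(F, ℝ) + #I`: by interval fibres each `J i` shares at most one top
with the union of all later sets. [folklore] -/
theorem sum_card_chartTops_le {ι : Type*} (I : Finset ι) (J : ι → Set ℝ) (σ : ℝ) (F : Finset (Fin 2 → ℝ))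
    (hord : ∀ i ∈ I, ∀ j ∈ I, i ≠ j →
      (∀ t ∈ J i, ∀ t' ∈ J j, t < t') ∨ (∀ t ∈ J i, ∀ t' ∈ J j, t' < t)) :
    ∑ i ∈ I, (F.filter fun x => ∃ t ∈ J i, IsStrictTop ![σ, t] F x).card ≤
      (F.filter fun x => ∃ t, IsStrictTop ![σ, t] F x).card + I.card := by
  classical
  set X : ι → Finset (Fin 2 → ℝ) := fun i => F.filter fun x => ∃ t ∈ J i, IsStrictTop ![σ, t] F x with hXdef
  set Xall := F.filter fun x => ∃ t, IsStrictTop ![σ, t] F x with hXall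
  -- `After i j`: every time of `J i` precedes every time of `J j`
  let After : ι → ι → Prop := fun i j => ∀ t ∈ J i, ∀ t' ∈ J j, t < t'
  -- the tops of `J i` not seen again later
  set D : ι → Finset (Fin 2 → ℝ) := fun i => (X i).filter fun x => ∀ j ∈ I, j ≠ i → After i j → x ∉ X j with hDdef
  have hXmem : ∀ i x, x ∈ X i ↔ x ∈ F ∧ ∃ t ∈ J i, IsStrictTop ![σ, t] F x := fun i x => by
    rw [hXdef, Finset.mem_filter]
  -- (1) at most one top of `J i` reappears later
  have h1 : ∀ i ∈ I, (X i).card ≤ (D i).card + 1 := by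
    intro i hi
    have hbad : ((X i).filter fun x => ¬ ∀ j ∈ I, j ≠ i → After i j → x ∉ X j).card ≤ 1 := by
      refine Finset.card_le_one.2 fun x hx x' hx' => ?_
      obtain ⟨hxX, hxbad⟩ := Finset.mem_filter.1 hx
      obtain ⟨hx'X, hx'bad⟩ := Finset.mem_filter.1 hx'
      push Not at hxbad hx'bad
      obtain ⟨j, hj, hji, hAj, hxj⟩ := hxbad
      obtain ⟨j', hj', hj'i, hAj', hx'j'⟩ := hx'bad
      obtain ⟨-, t, ht, htop⟩ := (hXmem i x).1 hxX
      obtain ⟨-, u, hu, hutop⟩ := (hXmem j x).1 hxj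
      obtain ⟨-, t', ht', ht'op⟩ := (hXmem i x').1 hx'X
      obtain ⟨-, u', hu', hu'top⟩ := (hXmem j' x').1 hx'j'
      have htu : t' < u := hAj t' ht' u hu
      have htu' : t < u' := hAj' t ht u' hu'
      rcases le_total u u' with huu' | huu'
      · exact ((ht'op.of_between hu'top htu.le huu').unique hutop).symm
      · exact (htop.of_between hutop htu'.le huu').unique hu'top
    have hsplit : (D i).card + ((X i).filter fun x => ¬ ∀ j ∈ I, j ≠ i → After i j → x ∉ X j).card = (X i).card :=
      Finset.card_filter_add_card_filter_not (s := X i) (fun x => ∀ j ∈ I, j ≠ i → After i j → x ∉ X j)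
    omega
  -- (2) the sets `D i` are pairwise disjoint and consist of tops
  have h2 : (I : Set ι).PairwiseDisjoint D := by
    intro i hi i' hi' hne
    rw [Function.onFun, Finset.disjoint_left]
    intro x hx hx'
    obtain ⟨hxX, hxD⟩ := Finset.mem_filter.1 hx
    obtain ⟨hx'X, hx'D⟩ := Finset.mem_filter.1 hx'
    rcases hord i hi i' hi' hne with h | h
    · exact hxD i' hi' (Ne.symm hne) h hx'X
    · exact hx'D i hi hne (fun t ht t' ht' => h t' ht' t ht) hxX
  have h3 : I.biUnion D ⊆ Xall := by
    intro x hx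
    obtain ⟨i, -, hxi⟩ := Finset.mem_biUnion.1 hx
    obtain ⟨hxF, t, -, htop⟩ := (hXmem i x).1 (Finset.mem_filter.1 hxi).1
    exact Finset.mem_filter.2 ⟨hxF, t, htop⟩
  calc ∑ i ∈ I, (X i).card ≤ ∑ i ∈ I, ((D i).card + 1) := Finset.sum_le_sum h1
    _ = (I.biUnion D).card + I.card := by
        rw [Finset.sum_add_distrib, Finset.sum_const, smul_eq_mul, mul_one, Finset.card_biUnion h2]
    _ ≤ Xall.card + I.card := Nat.add_le_add_right (Finset.card_le_card h3) _

/-! ### The two half-charts double-count at most two points -/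

/-- A strict top in BOTH half-charts `(1, t)` and `(-1, u)` is the unique top or the unique bottom point (add the weights).
[folklore] -/
theorem isStrictTop_vertical_of_charts {F : Finset (Fin 2 → ℝ)} {x : Fin 2 → ℝ} {t u : ℝ}
    (h₁ : IsStrictTop ![1, t] F x) (h₂ : IsStrictTop ![-1, u] F x) :
    IsStrictTop ![0, 1] F x ∨ IsStrictTop ![0, -1] F x := by
  rcases lt_or_ge 0 (t + u) with hpos | hle
  · refine Or.inl ⟨h₁.1, fun y hy hne => ?_⟩
    have e1 := h₁.2 y hy hne
    have e2 := h₂.2 y hy hne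
    simp only [chart_dotProduct] at e1 e2 ⊢
    nlinarith
  · rcases lt_or_eq_of_le hle with hneg | hzero
    · refine Or.inr ⟨h₁.1, fun y hy hne => ?_⟩
      have e1 := h₁.2 y hy hne
      have e2 := h₂.2 y hy hne
      simp only [chart_dotProduct] at e1 e2 ⊢
      nlinarith
    · refine Or.inl ⟨h₁.1, fun y hy hne => ?_⟩
      have e1 := h₁.2 y hy hne
      have e2 := h₂.2 y hy hne
      simp only [chart_dotProduct] at e1 e2 ⊢
      nlinarith

/-- The vertex set of the hull of a finite planar set is the set of its chart tops (both half-charts). [folklore] -/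
theorem extremePoints_eq_coe_filter_charts (F : Finset (Fin 2 → ℝ)) [DecidablePred fun x : Fin 2 → ℝ =>
      (∃ t : ℝ, IsStrictTop ![1, t] F x) ∨ ∃ t : ℝ, IsStrictTop ![-1, t] F x] :
    (convexHull ℝ (F : Set (Fin 2 → ℝ))).extremePoints ℝ =
      ↑(F.filter fun x => (∃ t : ℝ, IsStrictTop ![1, t] F x) ∨ ∃ t : ℝ, IsStrictTop ![-1, t] F x) := by
  ext x
  rw [Finset.coe_filter, Set.mem_setOf_eq, mem_extremePoints_iff_charts]
  constructor
  · rintro (⟨t, ht⟩ | ⟨t, ht⟩)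
    · exact ⟨ht.1, Or.inl ⟨t, ht⟩⟩
    · exact ⟨ht.1, Or.inr ⟨t, ht⟩⟩
  · exact fun h => h.2

open Classical in
/-- **`#tops₊ + #tops₋ ≤ #vert + 2`.**  The numbers of strict tops of `F` along the half-charts `(1, ·)` and `(-1, ·)` add up to
at most the number of hull vertices plus two (only the unique top and bottom points are counted twice). [folklore] -/
theorem card_chartTops_add_card_chartTops_le (F : Finset (Fin 2 → ℝ)) :
    (F.filter fun x => ∃ t, IsStrictTop ![1, t] F x).card + (F.filter fun x => ∃ t, IsStrictTop ![-1, t] F x).card ≤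
      ((convexHull ℝ (F : Set (Fin 2 → ℝ))).extremePoints ℝ).ncard + 2 := by
  classical
  set R := F.filter fun x => ∃ t, IsStrictTop ![1, t] F x with hR
  set L := F.filter fun x => ∃ t, IsStrictTop ![-1, t] F x with hL
  have hV : ((convexHull ℝ (F : Set (Fin 2 → ℝ))).extremePoints ℝ).ncard = (R ∪ L).card := by
    rw [extremePoints_eq_coe_filter_charts F, Set.ncard_coe_finset, Finset.filter_or]
  have hRL : (R ∪ L).card + (R ∩ L).card = R.card + L.card := Finset.card_union_add_card_inter _ _
  -- `R ∩ L` lies in {unique top} ∪ {unique bottom}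
  set tp := F.filter fun x => IsStrictTop ![0, 1] F x with htp
  set bt := F.filter fun x => IsStrictTop ![0, -1] F x with hbt
  have hI : (R ∩ L).card ≤ tp.card + bt.card := by
    refine (Finset.card_le_card fun x hx => ?_).trans (Finset.card_union_le _ _)
    rw [Finset.mem_inter, Finset.mem_filter, Finset.mem_filter] at hx
    obtain ⟨⟨hxF, t, ht⟩, -, u, hu⟩ := hx
    rw [Finset.mem_union, Finset.mem_filter, Finset.mem_filter]
    rcases isStrictTop_vertical_of_charts ht hu with h | h
    · exact Or.inl ⟨hxF, h⟩
    · exact Or.inr ⟨hxF, h⟩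
  have htp1 : tp.card ≤ 1 :=
    Finset.card_le_one.2 fun x hx y hy => (Finset.mem_filter.1 hx).2.unique (Finset.mem_filter.1 hy).2
  have hbt1 : bt.card ≤ 1 :=
    Finset.card_le_one.2 fun x hx y hy => (Finset.mem_filter.1 hx).2.unique (Finset.mem_filter.1 hy).2
  rw [hV]
  omega

end TotalsLaw

end Summit.ValiantsHypothesis.ValiantsHypothesis.Theorems.NewtonUnitEquationsDissociatedUniform
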